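import Literature.AlgebraicGeometry.HodgeTheory.HodgeGenericTypeStabilityOfGenericPoint
import Literature.AlgebraicGeometry.HodgeTheory.AlgebraicMonodromyMumfordTate
import Literature.AlgebraicGeometry.FundamentalGroup.HypersurfaceComplementMeridians
import Literature.AlgebraicGeometry.HodgeTheory.CyclicCoverMeridianMonodromy
import Literature.AlgebraicGeometry.HodgeTheory.CyclicCoverBaseChart
import Literature.AlgebraicGeometry.HodgeTheory.CyclicReflectionSystemOfMeridians
import Literature.AlgebraicGeometry.HodgeTheory.QbarFamilyLocalSystem
import Literature.AlgebraicGeometry.HodgeTheory.SymmetricHypersurfaceInvolution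
import Literature.AlgebraicGeometry.HodgeTheory.DiagonalSymmetryGysinEquivariance
import Literature.AlgebraicGeometry.Motives.MonomialSupportedHypersurfaceSymmetry
import Literature.AlgebraicGeometry.FundamentalGroup.HypersurfaceComplementMeridianExists
import Literature.AlgebraicGeometry.FundamentalGroup.HypersurfaceComplementMeridiansGenerate
import Literature.AlgebraicGeometry.HodgeTheory.CyclicCoverNodalMeridianLocalMonodromyBound
import Literature.AlgebraicGeometry.HodgeTheory.LocalMonodromyDatumConjugate
import Literature.AlgebraicGeometry.HodgeTheory.NodalTernaryFormUninodal
import Literature.AlgebraicGeometry.HodgeTheory.CyclicCoverNodalPencilMonodromyPackage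
import HarnessLib

/-!
# Carlson–Toledo 1999, §6: the local monodromy at a meridian of the discriminant centred at a ONE-NODAL branch curve — the
# named fact `HodgeTheory.carlsonToledo1999_nodalMeridianLocalMonodromyBound` HOLDS

J. A. Carlson, D. Toledo, *Discriminant complements and kernels of monodromy representations*, Duke Math. J. 97 (1999), §6 at the
degeneration (kdoublept), `σ`-free part, bound form, case `n = 1`, `k = d = p` odd, `p ≥ 3`: the local monodromy of a meridian of the
discriminant of the universal family of `p`-cyclic covers of the plane CENTRED AT A ONE-NODAL BRANCH CURVE is trivial modulo a
vanishing space of dimension at most `p − 1` on which `1 + T + ⋯ + T^{p−1} = 0` — the Literature named fact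
`HodgeTheory.carlsonToledo1999_nodalMeridianLocalMonodromyBound` (`HodgeTheory/CyclicCoverNodalMeridianLocalMonodromyBound`, with its
scope caveats), PROVED here under its exact name:

* Part 1 (namespace `…CyclicCoverMonodromy.MeridianTransport`) — rational transport along loops: uniqueness (`isRatTransport_unique`),
  the monodromy homomorphism (`exists_monodromyHom`), conjugate loops have conjugate transports (`exists_conj_of_isConj`),
  `mapOfEq_fromPath_mk`;
* Part 2 (namespace `…CyclicCoverMonodromy.PLPackageOfMeridians`) — the transport of `R² u_* ℚ` of the cyclic-cover family is
  rational (`isRationalClass_transportFun_cyclicCoverFamily`);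
* Part 3 (namespace `…CyclicCoverMonodromy.NodalMeridianOfCircle`) — from a rational transport datum on ONE small circle around the
  one-nodal centre to the bound at EVERY meridian with that centre: the universal derivative at a uninodal form is onto
  (`eval_pderiv_ne_zero_of_uninodal_of_prod_ne_zero`), meridians with small centre-direction exist
  (`exists_meridian_center_direction_small`), transports along homotopic/conjugate loops (`exists_isRatTransport_meridian_loop`),
  **`nodalMeridianLocalMonodromyBound_of_circle`**, `…_at_of_circle`;
* Part 4 (namespace `…CyclicCoverMonodromy.NodalMeridianMonodromy`) — the pencil circle of
  `HodgeTheory/CyclicCoverNodalPencilMonodromyPackage` is such a circle (`sum_monomial_nodalCircle`, `coeffVector_circle`,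
  `circle_datum`), and **`Literature.AlgebraicGeometry.HodgeTheory.carlsonToledo1999_nodalMeridianLocalMonodromyBound_holds`** — the
  named fact under its exact name.

Theorems only: no definition, no NEW named fact (net: one Literature named fact discharged under its exact name).

Provenance: Literature home (namespace `Literature.AlgebraicGeometry.HodgeTheory.CyclicCoverMonodromy.*`) of the declaration cone of
the Summits-side `HodgeConjecture/Theorems/CyclicUnitaryPowersNodalMeridianMonodromy :: carlsonToledo1999_nodalMeridianLocalMonodromyBound_holds`
(with slices of `…/SignSymmetricPowersMeridianMonodromy`, `…/CyclicUnitaryPowersPLPackageOfMeridians` and the whole of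
`…/CyclicUnitaryPowersNodalMeridianOfCircle`; route `CyclicUnitaryPowers`; imports `Literature/` and Mathlib only), which
`Literature/` may not import. Lane `lit-hodgefound`, seat p20.

## References

* [CarlsonToledo1999] J. A. Carlson, D. Toledo, *Discriminant complements and kernels of monodromy representations*, Duke Math.
  J. 97 (1999), §1, §2 (universalcyclic), §6 (kdoublept).
* [ArnoldGuseinzadeVarchenko2012] V. I. Arnold, S. M. Gusein-Zade, A. N. Varchenko, *Singularities of Differentiable Maps II*
  (2012), Part I §1.1 and §2.3 Thm. 2.2.
* [Dimca1992] A. Dimca, *Singularities and Topology of Hypersurfaces* (1992), Ch. 3 (1.19), Ch. 4 §1 and proof of Thm. (4.10).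
* [VoisinHodgeII2003] C. Voisin, *Hodge Theory and Complex Algebraic Geometry II* (2003), §2.3, §3.1.1, Thm. 3.16.
-/

/-! ## Part 1: Rational transport along loops: uniqueness, the monodromy homomorphism, conjugate meridians -/

noncomputable section

open _root_.CategoryTheory _root_.Topology
open Literature.AlgebraicTopology.SingularHomology
open Literature.AlgebraicGeometry.Motives
open Literature.AlgebraicGeometry.HodgeTheory

namespace Literature.AlgebraicGeometry.HodgeTheory.CyclicCoverMonodromy.MeridianTransport

/-! ### §1 The rational monodromy representation of a family on the fundamental group -/

section Family

variable {𝒳 S : SchemeOver ℂ} (f : 𝒳 ⟶ S) (k : ℕ) {U : Set (ComplexPoints S)}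
  (hU : IsCohomologicallyLocallyTrivialOn f U)

/-- Rational transport along a path class is unique (`Hᵏ(–; ℚ) ↪ Hᵏ(–; ℂ)`). [cite: VoisinHodgeII2003, §3.1.2] -/
theorem isRatTransport_unique {s t : U} {γ : Path.Homotopic.Quotient s t}
    {T T' : bettiCohomology (fiberOver f s.1) k ≃ₗ[ℚ] bettiCohomology (fiberOver f t.1) k}
    (hT : IsRatTransport f k hU γ T) (hT' : IsRatTransport f k hU γ T') : T = T' :=
  LinearEquiv.ext fun v => ofRatClass_injective k ((hT v).trans (hT' v).symm)

variable (hrat : ∀ (s t : U) (γ : Path.Homotopic.Quotient s t) (α : complexBetti (fiberOver f s.1) k),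
  IsRationalClass α → IsRationalClass (transportFun f k hU γ α))
include hrat

/-- **The rational monodromy representation** `ρ : π₁(U, s) →* GL(Hᵏ(X_s(ℂ); ℚ))` of a family whose
transport preserves rational classes: `ρ(c)` is the rational transport along the loop `c`, and the image of `ρ`
is the monodromy group `Γ_s = ratMonodromyGroup f k hU s`. (Existence statement; `ρ` is assembled from
`exists_ratTransport` by uniqueness.) [cite: VoisinHodgeII2003, §3.1.2] [cite: CarlsonMullerStachPeters2017, Lemma–Definition 15.3.7] -/
theorem exists_monodromyHom (s : U) :
    ∃ ρ : FundamentalGroup U s →* (bettiCohomology (fiberOver f s.1) k ≃ₗ[ℚ] bettiCohomology (fiberOver f s.1) k),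
      (∀ c, IsRatTransport f k hU (FundamentalGroup.toPath c) (ρ c)) ∧ ρ.range = ratMonodromyGroup f k hU s := by
  have hex : ∀ c : FundamentalGroup U s, ∃ T : bettiCohomology (fiberOver f s.1) k ≃ₗ[ℚ]
      bettiCohomology (fiberOver f s.1) k, IsRatTransport f k hU (FundamentalGroup.toPath c) T :=
    fun c => exists_ratTransport f k hU hrat _
  choose ρf hρf using hex
  refine ⟨{ toFun := ρf, map_one' := ?_, map_mul' := ?_ }, hρf, ?_⟩
  · exact isRatTransport_unique f k hU (hρf 1) (isRatTransport_refl f k hU s)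
  · intro a b
    apply isRatTransport_unique f k hU (hρf (a * b))
    rw [LinearEquiv.mul_eq_trans]
    exact (hρf b).trans f k hU (hρf a)
  · ext g
    constructor
    · rintro ⟨c, rfl⟩
      exact ⟨_, hρf c⟩
    · rintro ⟨γ, hγ⟩
      exact ⟨FundamentalGroup.fromPath γ, isRatTransport_unique f k hU (hρf _) hγ⟩

/-- **Conjugate loops have `Γ`-conjugate transports**: if the classes of two loops at `s` are conjugate in
`π₁(U, s)` and `T`, `T'` are the rational transports along them, then `T' = g T g⁻¹` for some `g` in the monodromy
group (the consumer of "meridians of one component are conjugate", `affineHypersurfaceComplement_meridian_isConj`).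
[cite: Deligne1974, proof of Thm. (5.4), p. 291] [cite: Shimada2010ZvK, §3 Prop. 3.4] -/
theorem exists_conj_of_isConj (s : U) {γ γ' : Path.Homotopic.Quotient s s}
    (hc : IsConj (FundamentalGroup.fromPath γ) (FundamentalGroup.fromPath γ'))
    {T T' : bettiCohomology (fiberOver f s.1) k ≃ₗ[ℚ] bettiCohomology (fiberOver f s.1) k}
    (hT : IsRatTransport f k hU γ T) (hT' : IsRatTransport f k hU γ' T') :
    ∃ g ∈ ratMonodromyGroup f k hU s, T' = g * T * g⁻¹ := by
  obtain ⟨ρ, hρ, hrange⟩ := exists_monodromyHom f k hU hrat s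
  obtain ⟨c, hcc⟩ := isConj_iff.1 hc
  have h1 : ρ (FundamentalGroup.fromPath γ) = T := isRatTransport_unique f k hU (hρ _) hT
  have h2 : ρ (FundamentalGroup.fromPath γ') = T' := isRatTransport_unique f k hU (hρ _) hT'
  refine ⟨ρ c, hrange ▸ ⟨c, rfl⟩, ?_⟩
  rw [← h2, ← hcc, map_mul, map_mul, map_inv, h1]

end Family

/-! ### §2 Transfer along a homeomorphism of the base -/

section Transfer

variable {X Y : Type} [TopologicalSpace X] [TopologicalSpace Y]

/-- The image of the class of a loop under the map induced by a pointed continuous map is the class of the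
image loop (with the endpoint cast). [cite: CarlsonToledo1999, §6] -/
theorem mapOfEq_fromPath_mk (φ : C(X, Y)) {x : X} {y : Y} (h : φ x = y) (γ : Path x x) :
    FundamentalGroup.mapOfEq φ h (FundamentalGroup.fromPath (Path.Homotopic.Quotient.mk γ)) =
      FundamentalGroup.fromPath (Path.Homotopic.Quotient.mk ((γ.map φ.continuous).cast h.symm h.symm)) := by
  rw [FundamentalGroup.mapOfEq_apply]
  rfl

end Transfer

end Literature.AlgebraicGeometry.HodgeTheory.CyclicCoverMonodromy.MeridianTransport

end

/-! ## Part 2: Rationality of the transport of the cyclic-cover family -/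

noncomputable section

open _root_.CategoryTheory MvPolynomial _root_.Topology
open Literature.AlgebraicTopology.SingularHomology
open Literature.AlgebraicGeometry.Motives Literature.AlgebraicGeometry.Motives.UniversalHypersurface
open Literature.AlgebraicGeometry.HodgeTheory Literature.AlgebraicGeometry.HodgeTheory.UniversalHypersurface
open Literature.AlgebraicGeometry.FundamentalGroup
open Literature.AlgebraicGeometry.HodgeTheory.CyclicCoverMonodromy.MeridianTransport

namespace Literature.AlgebraicGeometry.HodgeTheory.CyclicCoverMonodromy.PLPackageOfMeridians

/-! ### §1 The identification of the fibre with the model, compatible with the embeddings into `ℙ³` -/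

section FibreIso

variable (p : ℕ) [NeZero p]

end FibreIso

/-! ### §2 The covering automorphism on the fibre and its isometry -/

section Deck

variable {p : ℕ} {f : MvPolynomial (Fin 3) ℂ}

end Deck

/-! ### §3 Meridians: conjugates of meridian classes are meridian classes -/

section Meridians

variable {ι : Type} [Fintype ι] {m : ℕ} {h : Fin m → MvPolynomial ι ℂ}
  {s : affineHypersurfaceComplement h} {j : Fin m}

end Meridians

/-! ### §4 The package from the meridian facts -/

section Assembly

variable {p : ℕ} [NeZero p]

/-- Transport in `R² u_* ℂ` of the Carlson–Toledo family preserves rational classes (smooth projective family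
over the smooth quasi-projective base `S ⊆ 𝔸^{N+1}`). [cite: VoisinHodgeII2003, §3.1.2] -/
theorem isRationalClass_transportFun_cyclicCoverFamily
    (s t : (Set.univ : Set (ComplexPoints (cyclicCoverBase p)))) (γ : Path.Homotopic.Quotient s t)
    (α : complexBetti (fiberOver (cyclicCoverFamily p) s.1) 2) (hα : IsRationalClass α) :
    IsRationalClass (transportFun (cyclicCoverFamily p) 2 (cyclicCoverFamily_locallyTrivial p) γ α) := by
  haveI := smoothOfRelativeDimension_baseSpz_hom ℂ 2 p (cyclicCoverSpz p)
  exact isRationalClass_transportFun_of_isSmoothProjectiveFamily (cyclicCoverFamily p) 2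
    (0 + Nat.card (TernaryIndex p)) (isSmoothProjectiveFamily_cyclicCoverFamily p)
    (isQuasiProjectiveOver_baseSpz 2 p (cyclicCoverSpz p)) γ hα

end Assembly

/-! ### Rationality of the transport of the cyclic-cover family -/

section Crux

end Crux

end Literature.AlgebraicGeometry.HodgeTheory.CyclicCoverMonodromy.PLPackageOfMeridians

end

/-! ## Part 3: The local monodromy bound at a nodal meridian, from the pencil circle -/

noncomputable section

open MvPolynomial _root_.Topology _root_.Filter _root_.CategoryTheory
open Literature.AlgebraicTopology.SingularHomology
open Literature.AlgebraicGeometry.Motives Literature.AlgebraicGeometry.Motives.UniversalHypersurface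
open Literature.AlgebraicGeometry.HodgeTheory Literature.AlgebraicGeometry.HodgeTheory.DiscriminantBranches
open Literature.AlgebraicGeometry.FundamentalGroup
open Literature.NumberTheory.Transcendental (hasFDerivAt_eval)
open Literature.AlgebraicGeometry.HodgeTheory.CyclicCoverMonodromy.UninodalTernaryForm
open Literature.AlgebraicGeometry.HodgeTheory.CyclicCoverMonodromy.NodalMeridianExists
open Literature.AlgebraicGeometry.HodgeTheory.CyclicCoverMonodromy.MeridianTransport
open Literature.AlgebraicGeometry.HodgeTheory.CyclicCoverMonodromy.PLPackageOfMeridians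

namespace Literature.AlgebraicGeometry.HodgeTheory.CyclicCoverMonodromy.NodalMeridianOfCircle

/-! ### §1 The transversal direction `e_{x₂^p}` at the explicit one-nodal form -/

/-- The index of the monomial `x₂^p` among ternary forms of degree `p`. [cite: CarlsonToledo1999, §2 (held text p0004)] -/
theorem degree_single_two (p : ℕ) : (Finsupp.single (2 : Fin 3) p).degree = p :=
  Finsupp.degree_single _ _

/-- `ev_x(e_m) = x^m`: the evaluation functional at `x` on the coefficient direction of the monomial `m`.
[cite: VoisinHodgeII2003, §2.1.1 Cor. 2.8] -/
theorem evalCoeffCLM_single {n d : ℕ} (x : Fin (n + 2) → ℂ) (m : DegIndex n d) :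
    evalCoeffCLM n d x (Pi.single m 1) = m.1.prod fun j e => x j ^ e := by
  classical
  rw [evalCoeffCLM_apply, formOfCoeffs_def]
  rw [Finset.sum_eq_single m]
  · simp [eval_monomial]
  · intro b _ hb
    simp [hb]
  · intro h; exact absurd (Finset.mem_univ m) h

/-- **At a one-nodal form with node `x`, the partial `∂D/∂a_m` is non-zero as soon as `x^m ≠ 0`** (F-DISC-1:
`D = u·φ` near `a₁`, `dφ(a₁) = c·ev_x`, so `∂_m D(a₁) = u(a₁) c x^m`). [cite: VoisinHodgeII2003, §2.1.1 Lemma 2.7 and Cor. 2.8] -/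
theorem eval_pderiv_ne_zero_of_uninodal_of_prod_ne_zero {n d : ℕ} {Disc : MvPolynomial (DegIndex n d) ℂ}
    (hirr : Irreducible Disc) (hV : ∀ a : DegIndex n d → ℂ, a ∈ singularCoeffs n d ↔ eval a Disc = 0)
    {f₁ : MvPolynomial (Fin (n + 2)) ℂ} (hf₁ : f₁.IsHomogeneous d) {x : Fin (n + 2) → ℂ}
    (hnod : IsNodalFormWithNodes f₁ ![x]) (m : DegIndex n d) (hm : (m.1.prod fun j e => x j ^ e) ≠ 0) :
    eval (coeffsOf n d f₁) (pderiv m Disc) ≠ 0 := by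
  classical
  obtain ⟨W, hWo, haW, φ, u, c, hφ, hu, hu0, hDW⟩ :=
    discriminant_localBranches_nodal_holds n d 1 Disc hirr hV f₁ hf₁ ![x] hnod
  obtain ⟨-, hφ0, hc0, hdφ⟩ := hφ 0
  set a₁ := coeffsOf n d f₁ with ha₁
  have hdu : HasFDerivAt u (fderiv ℂ u a₁) a₁ :=
    ((hu a₁ haW).differentiableAt (hWo.mem_nhds haW)).hasFDerivAt
  have hprod : HasFDerivAt (fun a => u a * φ 0 a)
      (u a₁ • (c 0 • evalCoeffCLM n d (![x] 0)) + φ 0 a₁ • fderiv ℂ u a₁) a₁ := hdu.mul hdφ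
  have hEq : (fun a => eval a Disc) =ᶠ[𝓝 a₁] fun a => u a * φ 0 a := by
    filter_upwards [hWo.mem_nhds haW] with a ha
    rw [hDW a ha, Fin.prod_univ_one]
  have hD : HasFDerivAt (fun a => eval a Disc)
      (u a₁ • (c 0 • evalCoeffCLM n d (![x] 0)) + φ 0 a₁ • fderiv ℂ u a₁) a₁ :=
    hprod.congr_of_eventuallyEq hEq
  have hL := (hasFDerivAt_eval Disc a₁).unique hD
  have hLw := congrArg (fun L : (DegIndex n d → ℂ) →L[ℂ] ℂ => L (Pi.single m 1)) hL
  simp only [_root_.sum_apply, _root_.smul_apply, ContinuousLinearMap.proj_apply, smul_eq_mul,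
    _root_.add_apply, hφ0, zero_mul, add_zero, Matrix.cons_val_fin_one, evalCoeffCLM_single] at hLw
  rw [Finset.sum_eq_single m (fun b _ hb => by simp [hb]) (fun h => absurd (Finset.mem_univ m) h)]
    at hLw
  simp only [Pi.single_eq_same, mul_one] at hLw
  rw [hLw]
  exact mul_ne_zero (hu0 a₁ haW) (mul_ne_zero hc0 hm)

/-! ### §2 The transport along a meridian loop is the leash-conjugate of the circle transport -/

section Meridians

variable {p : ℕ} [NeZero p]

omit [NeZero p] in
/-- `cyclicCoverLoopClass p γ` is the class of `γ` read in the universe subtype (`rfl`). [cite: CarlsonToledo1999, §6] -/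
theorem cyclicCoverLoopClass_eq {s : ComplexPoints (cyclicCoverBase p)} (γ : Path s s) :
    cyclicCoverLoopClass p γ = Path.Homotopic.Quotient.mk
      (γ.map (continuous_id'.subtype_mk fun x : ComplexPoints (cyclicCoverBase p) => Set.mem_univ x)) := rfl

/-- **The transport along a meridian loop `leash · circle · leash⁻¹` read in `S(ℂ)`**: if `T_c` is a rational transport
along the circle, then for some rational transport `T_L` along the leash, `T_L.trans (T_c.trans T_L.symm)`
(`x ↦ T_L⁻¹(T_c(T_L x))`) is a rational transport along the class of the loop.
[cite: VoisinHodgeII2003, §3.1.2] [cite: Shimada2010ZvK, §3 Definition before Prop. 3.4] -/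
theorem exists_isRatTransport_meridian_loop {D : MvPolynomial (TernaryIndex p) ℂ}
    (χ : ComplexPoints (cyclicCoverBase p) ≃ₜ affineHypersurfaceComplement ![D])
    {b : affineHypersurfaceComplement ![D]} (μ : Meridian ![D] b 0)
    {Tc : bettiCohomology (fiberOver (cyclicCoverFamily p) (χ.symm μ.leashEnd)) 2 ≃ₗ[ℚ]
      bettiCohomology (fiberOver (cyclicCoverFamily p) (χ.symm μ.leashEnd)) 2}
    (hTc : IsRatTransport (cyclicCoverFamily p) 2 (cyclicCoverFamily_locallyTrivial p)
      (cyclicCoverLoopClass p (μ.circle.map χ.symm.continuous)) Tc) :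
    ∃ TL : bettiCohomology (fiberOver (cyclicCoverFamily p) (χ.symm b)) 2 ≃ₗ[ℚ]
        bettiCohomology (fiberOver (cyclicCoverFamily p) (χ.symm μ.leashEnd)) 2,
      IsRatTransport (cyclicCoverFamily p) 2 (cyclicCoverFamily_locallyTrivial p)
        (cyclicCoverLoopClass p (μ.loop.map χ.symm.continuous)) (TL.trans (Tc.trans TL.symm)) := by
  let L : Path (⟨χ.symm b, Set.mem_univ _⟩ : (Set.univ : Set (ComplexPoints (cyclicCoverBase p))))
      ⟨χ.symm μ.leashEnd, Set.mem_univ _⟩ :=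
    (μ.leash.map χ.symm.continuous).map
      (continuous_id'.subtype_mk fun x : ComplexPoints (cyclicCoverBase p) => Set.mem_univ x)
  obtain ⟨TL, hTL⟩ : ∃ TL : bettiCohomology (fiberOver (cyclicCoverFamily p) (χ.symm b)) 2 ≃ₗ[ℚ]
      bettiCohomology (fiberOver (cyclicCoverFamily p) (χ.symm μ.leashEnd)) 2,
      IsRatTransport (cyclicCoverFamily p) 2 (cyclicCoverFamily_locallyTrivial p) (Path.Homotopic.Quotient.mk L) TL :=
    exists_ratTransport (cyclicCoverFamily p) 2 (cyclicCoverFamily_locallyTrivial p)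
      (isRationalClass_transportFun_cyclicCoverFamily) (Path.Homotopic.Quotient.mk L)
  refine ⟨TL, ?_⟩
  have h := (hTL.trans _ _ _ hTc).trans _ _ _ hTL.symm
  have hpath : cyclicCoverLoopClass p (μ.loop.map χ.symm.continuous) =
      ((Path.Homotopic.Quotient.mk L).trans (cyclicCoverLoopClass p (μ.circle.map χ.symm.continuous))).trans
        (Path.Homotopic.Quotient.mk L).symm := by
    rw [cyclicCoverLoopClass_eq, cyclicCoverLoopClass_eq, ← Path.Homotopic.Quotient.mk_trans,
      ← Path.Homotopic.Quotient.mk_symm, ← Path.Homotopic.Quotient.mk_trans]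
    congr 1
    simp only [L, Meridian.loop, Path.map_trans]
    rfl
  rw [hpath]
  exact h

/-! ### §3 The explicit small meridian exists at every base point -/

omit [NeZero p] in
/-- **A meridian with prescribed centre, prescribed transversal direction and radius at most `ε₀`** at any base point
(`MeridianConj.exists_meridian` gives one of some radius; shrink the radius — the punctured disc only shrinks — and choose a new
leash by path-connectedness of the complement of the irreducible `V(D)`). [cite: Shimada2010ZvK, §3 (transversal discs)] -/
theorem exists_meridian_center_direction_small {D : MvPolynomial (TernaryIndex p) ℂ} (hD : D ≠ 0)
    (s : affineHypersurfaceComplement ![D]) {y v : TernaryIndex p → ℂ} (hy : eval y D = 0)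
    (htr : ∑ k, eval y (pderiv k D) * v k ≠ 0) {ε₀ : ℝ} (hε₀ : 0 < ε₀) :
    ∃ μ : Meridian ![D] s 0, μ.y = y ∧ μ.v = v ∧ μ.ε ≤ ε₀ := by
  have hU : IsPathConnected (affineHypersurfaceComplement ![D]) :=
    MeridianConj.isPathConnected_affineHypersurfaceComplement fun j => by fin_cases j; exact hD
  obtain ⟨μ₁, hy₁, hv₁⟩ := MeridianConj.exists_meridian hU s (j := 0) (y := y) (v := v) hy
    (fun i hi => absurd (Subsingleton.elim i 0) hi) htr
  subst hy₁ hv₁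
  -- shrink the radius to `ε := min μ₁.ε ε₀`
  set ε : ℝ := min μ₁.ε ε₀ with hε
  have hεpos : 0 < ε := lt_min μ₁.ε_pos hε₀
  have hdisc : ∀ c : ℂ, c ≠ 0 → ‖c‖ ≤ ε → discPoint μ₁.y μ₁.v c ∈ affineHypersurfaceComplement ![D] :=
    fun c hc0 hc => μ₁.discPoint_mem c hc0 (hc.trans (min_le_left _ _))
  have hend : discPoint μ₁.y μ₁.v (ε : ℂ) ∈ affineHypersurfaceComplement ![D] :=
    hdisc _ (by exact_mod_cast hεpos.ne') (by simp [abs_of_pos hεpos])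
  have hj : JoinedIn (affineHypersurfaceComplement ![D]) (s : TernaryIndex p → ℂ) (discPoint μ₁.y μ₁.v (ε : ℂ)) :=
    hU.joinedIn s s.2 _ hend
  let leash : Path s ⟨discPoint μ₁.y μ₁.v (ε : ℂ), hend⟩ :=
    ⟨⟨fun t => ⟨hj.somePath t, hj.somePath_mem t⟩, by fun_prop⟩, by ext; simp, by ext; simp⟩
  let μ : Meridian ![D] s 0 :=
    { y := μ₁.y, v := μ₁.v, ε := ε, ε_pos := hεpos, eval_center := μ₁.eval_center,
      eval_center_ne := μ₁.eval_center_ne, transversal := μ₁.transversal, discPoint_mem := hdisc,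
      leashEnd_mem := hend, leash := leash }
  exact ⟨μ, rfl, rfl, min_le_right _ _⟩

end Meridians

/-! ### §4 F1‡ from the circle -/

/-- **F1‡ at `p` from the explicit small circles.** Let `p ≥ 3`, `f₁ = x₂^{p−2}x₀x₁ + x₀^p + x₁^p` (the explicit one-nodal form),
`a₁` its coefficient vector and `m₀ = x₂^p`. Suppose that for some `ε₀ > 0`, for every irreducible equation `D` of the
discriminant, coefficient chart `χ` and meridian `μ` of `V(D)` with centre `a₁`, direction `e_{m₀}` and radius `≤ ε₀`, the
transport of `R²u_*ℚ` along the boundary circle of `μ` read in `S(ℂ)` carries the local-monodromy datum. Then the datum holds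
for the transport of EVERY meridian centred at a one-nodal branch curve (indeed at any centre) — the `p`-instance of
`carlsonToledo1999_nodalMeridianLocalMonodromyBound`. [cite: CarlsonToledo1999, §6 (kdoublept) and §3 (held text p0006, p0013–p0014)]
[cite: Shimada2010ZvK, §3 Prop. 3.4] -/
theorem nodalMeridianLocalMonodromyBound_of_circle {p : ℕ} [NeZero p] (hp3 : 3 ≤ p)
    (hG : ∃ ε₀ : ℝ, 0 < ε₀ ∧ ∀ (D : MvPolynomial (TernaryIndex p) ℂ), Irreducible D → IsDiscriminantEquation p D →
      ∀ (χ : ComplexPoints (cyclicCoverBase p) ≃ₜ affineHypersurfaceComplement ![D]), IsCoefficientChart p D χ →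
      ∀ {b : affineHypersurfaceComplement ![D]} (μ : Meridian ![D] b 0),
        μ.y = coeffsOf 1 p (X 2 ^ (p - 3 + 1) * (X 0 * X 1) + X 0 ^ (p - 3 + 3) + X 1 ^ (p - 3 + 3)) →
        μ.v = Pi.single ⟨Finsupp.single (2 : Fin 3) p, degree_single_two p⟩ 1 → μ.ε ≤ ε₀ →
        ∃ T : bettiCohomology (fiberOver (cyclicCoverFamily p) (χ.symm μ.leashEnd)) 2 ≃ₗ[ℚ]
            bettiCohomology (fiberOver (cyclicCoverFamily p) (χ.symm μ.leashEnd)) 2,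
          IsRatTransport (cyclicCoverFamily p) 2 (cyclicCoverFamily_locallyTrivial p)
            (cyclicCoverLoopClass p (μ.circle.map χ.symm.continuous)) T ∧
          ∃ V : Submodule ℚ (bettiCohomology (fiberOver (cyclicCoverFamily p) (χ.symm μ.leashEnd)) 2),
            (∀ x, T x - x ∈ V) ∧ (∀ v ∈ V, (∑ i ∈ Finset.range p, (T ^ i) v) = 0) ∧ Module.finrank ℚ V ≤ p - 1)
    (D : MvPolynomial (TernaryIndex p) ℂ) (hirr : Irreducible D) (hDeq : IsDiscriminantEquation p D)
    (χ : ComplexPoints (cyclicCoverBase p) ≃ₜ affineHypersurfaceComplement ![D]) (hχ : IsCoefficientChart p D χ)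
    (b : affineHypersurfaceComplement ![D]) (s : ComplexPoints (cyclicCoverBase p)) (hbs : χ.symm b = s)
    (μ : Meridian ![D] b 0) (γ : Path s s) (hγ : ∀ θ, χ (γ θ) = μ.loop θ) :
    ∃ (T : bettiCohomology (fiberOver (cyclicCoverFamily p) s) 2 ≃ₗ[ℚ] bettiCohomology (fiberOver (cyclicCoverFamily p) s) 2)
      (V : Submodule ℚ (bettiCohomology (fiberOver (cyclicCoverFamily p) s) 2)),
      IsRatTransport (cyclicCoverFamily p) 2 (cyclicCoverFamily_locallyTrivial p) (cyclicCoverLoopClass p γ) T ∧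
      (∀ x, T x - x ∈ V) ∧
      (∀ v ∈ V, (∑ i ∈ Finset.range p, (T ^ i) v) = 0) ∧
      Module.finrank ℚ V ≤ p - 1 := by
  classical
  subst hbs
  obtain ⟨m, rfl⟩ : ∃ m, p = m + 3 := ⟨p - 3, by omega⟩
  simp only [show m + 3 - 3 = m by omega] at hG
  obtain ⟨ε₀, hε₀, hG⟩ := hG
  haveI hfin : ∀ t : ComplexPoints (cyclicCoverBase (m + 3)),
      Module.Finite ℚ (bettiCohomology (fiberOver (cyclicCoverFamily (m + 3)) t) 2) := fun t =>
    BettiUniverse.finite ((isSmoothProjectiveFamily_cyclicCoverFamily (m + 3)).isSmoothProjective t) 2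
  -- the given loop IS the meridian loop read through `χ⁻¹`
  have hγeq : γ = μ.loop.map χ.symm.continuous := by
    refine Path.ext (funext fun θ => ?_)
    have h := congrArg χ.symm (hγ θ)
    rwa [χ.symm_apply_apply] at h
  -- the explicit one-nodal form and its transversal direction
  set f₁ : MvPolynomial (Fin 3) ℂ := X 2 ^ (m + 1) * (X 0 * X 1) + X 0 ^ (m + 3) + X 1 ^ (m + 3) with hf₁
  have hf₁h : f₁.IsHomogeneous (m + 3) := isHomogeneous_nodalTernaryForm m
  have hnod : IsNodalFormWithNodes (n := 1) f₁ ![![0, 0, 1]] := isNodalFormWithNodes_nodalTernaryForm m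
  set m₀ : TernaryIndex (m + 3) := ⟨Finsupp.single (2 : Fin 3) (m + 3), degree_single_two (m + 3)⟩ with hm₀
  have hV : ∀ a : DegIndex 1 (m + 3) → ℂ, a ∈ singularCoeffs 1 (m + 3) ↔ eval a D = 0 :=
    mem_singularCoeffs_iff_of_isDiscriminantEquation (by omega) hDeq
  have hy : eval (coeffsOf 1 (m + 3) f₁) D = 0 :=
    (hV _).1 (coeffsOf_mem_singularCoeffs_of_uninodal (by omega) hf₁h hnod)
  have htr : ∑ k, eval (coeffsOf 1 (m + 3) f₁) (pderiv k D) * (Pi.single m₀ (1 : ℂ) : TernaryIndex (m + 3) → ℂ) k ≠ 0 := by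
    rw [Finset.sum_eq_single m₀ (fun b _ hb => by simp [hb])
      (fun h => absurd (Finset.mem_univ m₀) h)]
    simp only [Pi.single_eq_same, mul_one]
    refine eval_pderiv_ne_zero_of_uninodal_of_prod_ne_zero hirr hV hf₁h hnod m₀ ?_
    rw [hm₀, Finsupp.prod_single_index (by simp)]
    simp
  -- the explicit small meridian at the same base point `b`, its circle and leash transports
  obtain ⟨μ₀, hμ₀y, hμ₀v, hμ₀ε⟩ :=
    exists_meridian_center_direction_small (p := m + 3) hirr.ne_zero b hy htr hε₀
  obtain ⟨Tc, hTc, hdat⟩ := hG D hirr hDeq χ hχ μ₀ hμ₀y hμ₀v hμ₀ε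
  obtain ⟨TL, hloop₀⟩ := exists_isRatTransport_meridian_loop χ μ₀ hTc
  have hdat₀ := exists_localMonodromyDatum_of_conj (p := m + 3) (m := m + 3 - 1) Tc TL hdat
  -- a transport along the loop of `μ`
  obtain ⟨T, hT⟩ := exists_ratTransport (cyclicCoverFamily (m + 3)) 2 (cyclicCoverFamily_locallyTrivial (m + 3))
    (isRationalClass_transportFun_cyclicCoverFamily) (cyclicCoverLoopClass (m + 3) (μ.loop.map χ.symm.continuous))
  -- the two loops are conjugate in `π₁(S(ℂ))`: push the meridian conjugacy through `χ⁻¹`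
  have hirr' : ∀ j : Fin 1, Irreducible ((![D] : Fin 1 → MvPolynomial (TernaryIndex (m + 3)) ℂ) j) := fun j => by
    fin_cases j; exact hirr
  have hconjμ : IsConj μ₀.loopClass μ.loopClass :=
    affineHypersurfaceComplement_meridian_isConj_holds (TernaryIndex (m + 3)) 1 ![D] hirr' b 0 μ₀ μ
  let Ψ : (Set.univ : Set (ComplexPoints (cyclicCoverBase (m + 3)))) ≃ₜ affineHypersurfaceComplement ![D] :=
    (Homeomorph.Set.univ _).trans χ
  have hΨ : Ψ.symm b = ⟨χ.symm b, Set.mem_univ _⟩ := rfl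
  let φ := FundamentalGroup.mapOfEq (Ψ.symm : C(affineHypersurfaceComplement ![D],
    (Set.univ : Set (ComplexPoints (cyclicCoverBase (m + 3)))))) hΨ
  have hφ : ∀ ν : Meridian ![D] b 0, φ ν.loopClass =
      FundamentalGroup.fromPath (cyclicCoverLoopClass (m + 3) (ν.loop.map χ.symm.continuous)) := by
    intro ν
    dsimp only [φ]
    erw [Meridian.loopClass_def, mapOfEq_fromPath_mk]
    change FundamentalGroup.fromPath (Path.Homotopic.Quotient.mk _) = FundamentalGroup.fromPath (Path.Homotopic.Quotient.mk _)
    congr 2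
  have hconj : IsConj (FundamentalGroup.fromPath (cyclicCoverLoopClass (m + 3) (μ₀.loop.map χ.symm.continuous)))
      (FundamentalGroup.fromPath (cyclicCoverLoopClass (m + 3) (μ.loop.map χ.symm.continuous))) := by
    rw [← hφ μ₀, ← hφ μ]
    exact MonoidHom.map_isConj φ hconjμ
  obtain ⟨g, -, hg⟩ := exists_conj_of_isConj (cyclicCoverFamily (m + 3)) 2 (cyclicCoverFamily_locallyTrivial (m + 3))
    (isRationalClass_transportFun_cyclicCoverFamily) _ hconj hloop₀ hT
  obtain ⟨V, hV₁, hV₂, hV₃⟩ := exists_localMonodromyDatum_of_mul_conj (p := m + 3) (m := m + 3 - 1) _ g hdat₀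
  refine ⟨T, V, ?_, ?_, ?_, hV₃⟩
  · rw [hγeq]; exact hT
  · intro x; rw [hg]; exact hV₁ x
  · intro v hv; rw [hg]; exact hV₂ v hv

/-- **The `p`-instance of F1‡ from the explicit small circles**, in the exact quantifier shape of
`carlsonToledo1999_nodalMeridianLocalMonodromyBound` (the hypothesis that the centre of `μ` is one-nodal is not even needed:
all meridians of the irreducible discriminant are conjugate). [cite: CarlsonToledo1999, §6 (kdoublept) (held text p0013–p0014)]
[cite: Shimada2010ZvK, §3 Prop. 3.4] -/
theorem nodalMeridianLocalMonodromyBound_at_of_circle {p : ℕ} [NeZero p] (hp3 : 3 ≤ p)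
    (hG : ∃ ε₀ : ℝ, 0 < ε₀ ∧ ∀ (D : MvPolynomial (TernaryIndex p) ℂ), Irreducible D → IsDiscriminantEquation p D →
      ∀ (χ : ComplexPoints (cyclicCoverBase p) ≃ₜ affineHypersurfaceComplement ![D]), IsCoefficientChart p D χ →
      ∀ {b : affineHypersurfaceComplement ![D]} (μ : Meridian ![D] b 0),
        μ.y = coeffsOf 1 p (X 2 ^ (p - 3 + 1) * (X 0 * X 1) + X 0 ^ (p - 3 + 3) + X 1 ^ (p - 3 + 3)) →
        μ.v = Pi.single ⟨Finsupp.single (2 : Fin 3) p, degree_single_two p⟩ 1 → μ.ε ≤ ε₀ →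
        ∃ T : bettiCohomology (fiberOver (cyclicCoverFamily p) (χ.symm μ.leashEnd)) 2 ≃ₗ[ℚ]
            bettiCohomology (fiberOver (cyclicCoverFamily p) (χ.symm μ.leashEnd)) 2,
          IsRatTransport (cyclicCoverFamily p) 2 (cyclicCoverFamily_locallyTrivial p)
            (cyclicCoverLoopClass p (μ.circle.map χ.symm.continuous)) T ∧
          ∃ V : Submodule ℚ (bettiCohomology (fiberOver (cyclicCoverFamily p) (χ.symm μ.leashEnd)) 2),
            (∀ x, T x - x ∈ V) ∧ (∀ v ∈ V, (∑ i ∈ Finset.range p, (T ^ i) v) = 0) ∧ Module.finrank ℚ V ≤ p - 1)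
    (f : MvPolynomial (Fin 3) ℂ) (D : MvPolynomial (TernaryIndex p) ℂ) (hirr : Irreducible D) (hDeq : IsDiscriminantEquation p D)
    (χ : ComplexPoints (cyclicCoverBase p) ≃ₜ affineHypersurfaceComplement ![D]) (hχ : IsCoefficientChart p D χ)
    (μ : Meridian ![D] (χ (cyclicCoverPoint p f)) 0)
    (γ : Path (cyclicCoverPoint p f) (cyclicCoverPoint p f)) (hγ : ∀ θ, χ (γ θ) = μ.loop θ) :
    ∃ (T : bettiCohomology (fiberOver (cyclicCoverFamily p) (cyclicCoverPoint p f)) 2 ≃ₗ[ℚ]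
          bettiCohomology (fiberOver (cyclicCoverFamily p) (cyclicCoverPoint p f)) 2)
      (V : Submodule ℚ (bettiCohomology (fiberOver (cyclicCoverFamily p) (cyclicCoverPoint p f)) 2)),
      IsRatTransport (cyclicCoverFamily p) 2 (cyclicCoverFamily_locallyTrivial p) (cyclicCoverLoopClass p γ) T ∧
      (∀ x, T x - x ∈ V) ∧
      (∀ v ∈ V, (∑ i ∈ Finset.range p, (T ^ i) v) = 0) ∧
      Module.finrank ℚ V ≤ p - 1 :=
  nodalMeridianLocalMonodromyBound_of_circle hp3 hG D hirr hDeq χ hχ _ _ (χ.symm_apply_apply _) μ γ hγ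

end Literature.AlgebraicGeometry.HodgeTheory.CyclicCoverMonodromy.NodalMeridianOfCircle

end

/-! ## Part 4: The named fact `carlsonToledo1999_nodalMeridianLocalMonodromyBound` holds -/

noncomputable section

open _root_.CategoryTheory _root_.AlgebraicGeometry MvPolynomial TopologicalSpace Set _root_.Topology Filter
open scoped Real unitInterval
open Literature.AlgebraicGeometry.Motives Literature.AlgebraicGeometry.Motives.UniversalHypersurface
open Literature.AlgebraicGeometry.HodgeTheory Literature.AlgebraicGeometry.HodgeTheory.UniversalHypersurface
open Literature.AlgebraicGeometry.FundamentalGroup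
open Literature.AlgebraicTopology.SingularHomology
open Literature.AlgebraicGeometry.HodgeTheory.CyclicCoverMonodromy.UninodalTernaryForm
open Literature.AlgebraicGeometry.HodgeTheory.CyclicCoverMonodromy.NodalMeridianOfCircle
open Literature.AlgebraicGeometry.HodgeTheory.CyclicCoverMonodromy.NodalPencilPackage
open Literature.AlgebraicGeometry.HodgeTheory.CyclicCoverMonodromy.NodalPencilCircleDatum

namespace Literature.AlgebraicGeometry.HodgeTheory.CyclicCoverMonodromy.NodalMeridianMonodromy

/-! ### §1 The branch forms along the circle of the explicit meridian -/

/-- **The ternary form with coefficient vector `coeffsOf f₁ + c·e_{x₂^p}` is `f₁ + c x₂^p`** (`p = m + 3`).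
[cite: CarlsonToledo1999, §6 (kdoublept)] -/
theorem sum_monomial_nodalCircle (m : ℕ) (c : ℂ) :
    (∑ e : TernaryIndex (m + 3), monomial e.1
        ((coeffsOf 1 (m + 3) (X 2 ^ (m + 1) * (X 0 * X 1) + X 0 ^ (m + 3) + X 1 ^ (m + 3)) +
          c • (Pi.single (⟨Finsupp.single (2 : Fin 3) (m + 3), degree_single_two (m + 3)⟩ : TernaryIndex (m + 3)) (1 : ℂ) :
            TernaryIndex (m + 3) → ℂ)) e)) =
      (X 2 ^ (m + 1) * (X 0 * X 1) + X 0 ^ (m + 3) + X 1 ^ (m + 3)) + c • X 2 ^ (m + 3) := by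
  classical
  set w : TernaryIndex (m + 3) → ℂ := coeffsOf 1 (m + 3) (X 2 ^ (m + 1) * (X 0 * X 1) + X 0 ^ (m + 3) + X 1 ^ (m + 3)) +
    c • (Pi.single (⟨Finsupp.single (2 : Fin 3) (m + 3), degree_single_two (m + 3)⟩ : TernaryIndex (m + 3)) (1 : ℂ) :
      TernaryIndex (m + 3) → ℂ) with hw
  have hRHS : ((X 2 ^ (m + 1) * (X 0 * X 1) + X 0 ^ (m + 3) + X 1 ^ (m + 3)) + c • X 2 ^ (m + 3) :
      MvPolynomial (Fin 3) ℂ).IsHomogeneous (m + 3) := by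
    rw [smul_eq_C_mul]
    refine (isHomogeneous_nodalTernaryForm m).add ?_
    simpa using (isHomogeneous_C (Fin 3) c).mul ((isHomogeneous_X ℂ (2 : Fin 3)).pow (m + 3))
  refine MvPolynomial.ext _ _ fun e => ?_
  by_cases he : e.degree = m + 3
  · have h1 := coeff_sum_monomial (m + 3) w ⟨e, he⟩
    change coeff e _ = _ at h1
    rw [h1, hw, Pi.add_apply, Pi.smul_apply, coeffsOf_apply, smul_eq_mul]
    conv_rhs => rw [coeff_add, coeff_smul, coeff_X_pow, smul_eq_mul]
    congr 1
    by_cases h2 : Finsupp.single (2 : Fin 3) (m + 3) = e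
    · subst h2
      rw [if_pos rfl, Pi.single_eq_same]
    · rw [if_neg h2, Pi.single_eq_of_ne (fun h => h2 (congrArg Subtype.val h).symm)]
  · rw [(isHomogeneous_sum_monomial (m + 3) w).coeff_eq_zero he, hRHS.coeff_eq_zero he]

/-- **Along the boundary circle of the explicit meridian, read through a coefficient chart, the quaternary coefficient vectors are
`b(x₃^p − f₁) − εe^{2πiu}·e_{x₂^p}`.** [cite: CarlsonToledo1999, §2 (held text p0004), §6 (kdoublept)] -/
theorem coeffVector_circle {m : ℕ} {D : MvPolynomial (TernaryIndex (m + 3)) ℂ}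
    (χ : ComplexPoints (cyclicCoverBase (m + 3)) ≃ₜ affineHypersurfaceComplement ![D]) (hχ : IsCoefficientChart (m + 3) D χ)
    {b : affineHypersurfaceComplement ![D]} (μ : Meridian ![D] b 0)
    (hy : μ.y = coeffsOf 1 (m + 3) (X 2 ^ (m + 1) * (X 0 * X 1) + X 0 ^ (m + 3) + X 1 ^ (m + 3)))
    (hv : μ.v = Pi.single ⟨Finsupp.single (2 : Fin 3) (m + 3), degree_single_two (m + 3)⟩ 1) (u : I) :
    coeffVector ℂ 2 (m + 3) (AlgPoints.map (toBaseSpz ℂ 2 (m + 3) (cyclicCoverSpz (m + 3))) ((μ.circle.map χ.symm.continuous) u)) =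
      coeffsOf 2 (m + 3) (cyclicCoverForm (m + 3) (X 2 ^ (m + 3 - 2) * (X 0 * X 1) + X 0 ^ (m + 3) + X 1 ^ (m + 3))) -
        Pi.single (regPowIndex 2 (m + 3) 2) (Complex.exp (((2 * π * u : ℝ) : ℂ) * Complex.I) * μ.ε) := by
  haveI : NeZero (m + 3) := ⟨by omega⟩
  set t : ComplexPoints (cyclicCoverBase (m + 3)) := (μ.circle.map χ.symm.continuous) u with ht
  set c : ℂ := Complex.exp (((2 * π * u : ℝ) : ℂ) * Complex.I) * μ.ε with hc
  -- the branch form of `t` is `f₁ + c x₂^p`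
  have hχt : (χ t : TernaryIndex (m + 3) → ℂ) = μ.circlePoint u := by
    rw [ht, Path.map_coe, Function.comp_apply, χ.apply_symm_apply, Meridian.coe_circle_apply]
  have hcoeff : ∀ e : TernaryIndex (m + 3), (branchForm (m + 3) t).coeff e.1 = (μ.y + c • μ.v) e := by
    intro e
    rw [← hχ t e, hχt, Meridian.circlePoint, discPoint, hc]
    push_cast
    ring
  have hbranch : branchForm (m + 3) t = (X 2 ^ (m + 1) * (X 0 * X 1) + X 0 ^ (m + 3) + X 1 ^ (m + 3)) + c • X 2 ^ (m + 3) := by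
    rw [← sum_monomial_coeff_branchForm, ← sum_monomial_nodalCircle m c]
    refine Finset.sum_congr rfl fun e _ => ?_
    rw [hcoeff e, hy, hv]
  funext mm
  have key := formOfCoeffs_nodalPencil (p := m + 3) (by omega) c
  rw [show m + 3 - 2 = m + 1 by omega] at key ⊢
  rw [coeffVector_map_toBaseSpz, sum_monomial_coeff_branchForm, hbranch, ← key, coeff_formOfCoeffs]

/-! ### §2 F1‡ -/

/-- **The geometric input `hG` of `nodalMeridianLocalMonodromyBound_of_circle`**: for `p ≥ 3` there is `ε₀ > 0` such that for every
irreducible equation `D` of the discriminant, coefficient chart `χ` and meridian `μ` with centre `f₁`, direction `x₂^p` and radius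
`≤ ε₀`, the rational transport along the boundary circle of `μ` read in `S(ℂ)` exists and carries the local-monodromy datum.
[cite: CarlsonToledo1999, §6 (kdoublept) (held text p0013–p0014)] -/
theorem circle_datum {p : ℕ} [NeZero p] (hp3 : 3 ≤ p) :
    ∃ ε₀ : ℝ, 0 < ε₀ ∧ ∀ (D : MvPolynomial (TernaryIndex p) ℂ), Irreducible D → IsDiscriminantEquation p D →
      ∀ (χ : ComplexPoints (cyclicCoverBase p) ≃ₜ affineHypersurfaceComplement ![D]), IsCoefficientChart p D χ →
      ∀ {b : affineHypersurfaceComplement ![D]} (μ : Meridian ![D] b 0),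
        μ.y = coeffsOf 1 p (X 2 ^ (p - 3 + 1) * (X 0 * X 1) + X 0 ^ (p - 3 + 3) + X 1 ^ (p - 3 + 3)) →
        μ.v = Pi.single ⟨Finsupp.single (2 : Fin 3) p, degree_single_two p⟩ 1 → μ.ε ≤ ε₀ →
        ∃ T : bettiCohomology (fiberOver (cyclicCoverFamily p) (χ.symm μ.leashEnd)) 2 ≃ₗ[ℚ]
            bettiCohomology (fiberOver (cyclicCoverFamily p) (χ.symm μ.leashEnd)) 2,
          IsRatTransport (cyclicCoverFamily p) 2 (cyclicCoverFamily_locallyTrivial p)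
            (cyclicCoverLoopClass p (μ.circle.map χ.symm.continuous)) T ∧
          ∃ V : Submodule ℚ (bettiCohomology (fiberOver (cyclicCoverFamily p) (χ.symm μ.leashEnd)) 2),
            (∀ x, T x - x ∈ V) ∧ (∀ v ∈ V, (∑ i ∈ Finset.range p, (T ^ i) v) = 0) ∧ Module.finrank ℚ V ≤ p - 1 := by
  obtain ⟨m, rfl⟩ : ∃ m, p = m + 3 := ⟨p - 3, by omega⟩
  obtain ⟨ε₀, hε₀, hcirc⟩ := exists_isRatTransport_datum_pencilCircle (p := m + 3) hp3
  refine ⟨ε₀ / 2, by positivity, fun D _ _ χ hχ b μ hy hv hε => ?_⟩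
  simp only [show m + 3 - 3 = m by omega] at hy
  have hε0 : ((μ.ε : ℝ) : ℂ) ≠ 0 := by exact_mod_cast μ.ε_pos.ne'
  have hεn : ‖((μ.ε : ℝ) : ℂ)‖ < ε₀ := by
    rw [Complex.norm_real, Real.norm_eq_abs, abs_of_pos μ.ε_pos]; linarith
  obtain ⟨T, V, hT, hV₁, hV₂, hV₃⟩ := hcirc (μ.ε : ℂ) hε0 hεn (μ.circle.map χ.symm.continuous)
    (fun u => coeffVector_circle χ hχ μ hy hv u)
  exact ⟨T, hT, V, hV₁, hV₂, hV₃⟩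

/-- **F1‡ proved: the nodal-meridian local-monodromy bound of Carlson–Toledo 1999 §6 (kdoublept).**
[cite: CarlsonToledo1999, §6 (kdoublept) and §3 (held text p0006, p0013–p0014)] -/
theorem _root_.Literature.AlgebraicGeometry.HodgeTheory.carlsonToledo1999_nodalMeridianLocalMonodromyBound_holds :
    carlsonToledo1999_nodalMeridianLocalMonodromyBound := by
  intro p _ _ hp3 f _ _ _ D hirr hDeq χ hχ μ _ γ hγ
  exact nodalMeridianLocalMonodromyBound_at_of_circle hp3 (circle_datum hp3) f D hirr hDeq χ hχ μ γ hγ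

end Literature.AlgebraicGeometry.HodgeTheory.CyclicCoverMonodromy.NodalMeridianMonodromy

end
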